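import Literature.AnabelianGeometry.SemiGraphs.TemperedPiVertexGenerated
import HarnessLib

/-!
# [SemiAnbd] Thm 3.7 (iii) p. 41: an element of `ker π_n` conjugate into a decomposition group lies in
# `ker ρ_n` — the capstone binders `hfree` / `hT` / `hL` at `π₁^temp(𝒢)` (T54-B, piece hfree-inst)

Mochizuki, *Semi-graphs of anabelioids*, Publ. RIMS **42** (2006), proof of Thm. 3.7 (iii) p. 41
("`𝒢_{∞,i} → 𝒢_i` … the universal graph-covering of `𝒢_i`"; the deck group `Gal(𝒢_{∞,i}/𝒢_i) = π₁(𝔾_i)`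
acts freely on the tree `𝒢_{∞,i}`) and Prop. 3.6 p. 38 (`Gal(𝒢_{∞,i}/𝒢) ↠ Gal(𝒢_i/𝒢)`)
[cite: MochizukiSemiAnbd2006, Thm 3.7(iii) p.41].

PROOF-ONLY (cell row T54-B, producer debt `HOME/plan/GAP-LEDGER.md` G-w4d053-1; node SemiAnbd:Thm5.4).
abc-iut-w4-d053's constructor `ArithLevelDataCpt.ofCosetTower` carries the binder
`hfree : ∀ j w z x, x ∈ L j → z * x * z⁻¹ ∈ P.H w → x ∈ K j` ("`L_j ∩ z⁻¹ H_w z ≤ K_j`": the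
transition `cosetGraph K_j → cosetGraph L_j` is an immersion).  THIS FILE proves it at abc-iut-L3-t9's
Galois tower with `P := D.piPresentation h𝒢 T R` (abc-iut-L3-d4), tree levels `K j := ker ρ_j`
(`D.projAut`) and finite levels `L j := ker π_j` (abc-iut-L3-d4's `D.piLevelAut`):

* **`piPresentation_hfree`** — the binder text of `hfree` VERBATIM at
  `(K, L) := (fun j => ker (D.projAut h𝒢 j), fun j => ker (D.piLevelAut h𝒢 hconn j))`: bookkeeping over
  abc-iut-L3-d4's `ker_piLevelAut_inf_conj_le` (`ker π_n ⊓ g H_w g⁻¹ ≤ ker ρ_n`: an element of the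
  decomposition group `g H_w g⁻¹` acting trivially on `𝒢_{S n}` is a deck transformation of
  `𝒢_{∞,n} → 𝒢_{S n}` FIXING a tree vertex, hence trivial — abc-iut-L3-t9's
  `gal_eq_one_of_descendBaseAut_eq_one_of_fixes`), at `g := z⁻¹`; `piPresentation_hfreeM` — the same with
  the edge groups `M_e` (`M_e ≤ H_{ν e}`);
* `ker_piLevelAut_anti` — the finite-level kernels are antitone (the capstone's `hL`; from abc-iut-L3-d4's
  `ker_piLevelAut_succ_le`); `piPresentation_hT` — the tree levels `cosetGraph (ker ρ_j)` are trees (the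
  capstone's `hT`, along abc-iut-L3-d4's `treeCosetIso`); `piPresentation_M_le_H` (bookkeeping).

Nothing here refers to the IUT corpus; no side is taken on [IUTchIII] Cor 3.12; typed ≠ proved for Thm 5.4 itself.
-/

namespace Literature.AnabelianGeometry.SemiGraphs

namespace ProfiniteSemiGraph

namespace GaloisLevelData

open CategoryTheory

universe u

variable {𝒢 : ProfiniteSemiGraph.{u}} (D : GaloisLevelData 𝒢) (h𝒢 : 𝒢.IsCountable)
  (hconn : ∀ (n : ℕ) (p q : (D.S n).Point), (D.S n).SameComponent p q)
  (T : ∀ w : 𝒢.graph.Vertex, D.PointSeq h𝒢 w) (R : SemiGraph.RefBranches 𝒢.graph)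

/-- The finite-level kernels `ker π_n` are antitone in `n` (the capstone's `hL`).
[cite: MochizukiSemiAnbd2006, Prop 3.6 p.38] -/
theorem ker_piLevelAut_anti ⦃i j : ℕ⦄ (h : i ≤ j) :
    (D.piLevelAut h𝒢 hconn j).ker ≤ (D.piLevelAut h𝒢 hconn i).ker :=
  antitone_nat_of_succ_le (f := fun n => (D.piLevelAut h𝒢 hconn n).ker) (D.ker_piLevelAut_succ_le h𝒢 hconn) h

/-- The tree levels of the presentation ARE trees: `(D.piPresentation T R).cosetGraph (ker ρ_j) ≅ 𝒢_{∞,j}`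
(abc-iut-L3-d4's `treeCosetIso`) and `𝒢_{∞,j}` is a tree — the capstone's binder `hT` at `K j := ker ρ_j`.
[cite: MochizukiSemiAnbd2006, Thm 3.7(iii) p.41] -/
theorem piPresentation_hT (j : ℕ) :
    ((D.piPresentation h𝒢 T R).cosetGraph (D.projAut h𝒢 j).ker).IsTree :=
  SemiGraph.IsTree.of_iso (D.treeCosetIso h𝒢 T R j).symm (D.isTree_tree j)

/-- The edge groups of the presentation lie in the vertex groups of their reference vertices:
`M_e ≤ H_{ν e}`. [cite: MochizukiSemiAnbd2006, Thm 3.7(i) p.40] -/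
theorem piPresentation_M_le_H (e : 𝒢.graph.Edge) :
    (D.piPresentation h𝒢 T R).M e ≤ (D.piPresentation h𝒢 T R).H (R.ν e) := by
  rw [D.piPresentation_M, D.piPresentation_H]
  exact Subgroup.map_le_range _ _

/-- **`hfree` at `π₁^temp(𝒢)`**: an element of `ker π_j` conjugate into a vertex group `H_w` lies in
`ker ρ_j` — the binder `hfree` of `ArithLevelDataCpt.ofCosetTower` VERBATIM at
`K j := ker (D.projAut j)`, `L j := ker (D.piLevelAut j)`, no hypothesis (abc-iut-L3-d4's
`ker_piLevelAut_inf_conj_le` at `g := z⁻¹`). [cite: MochizukiSemiAnbd2006, Thm 3.7(iii) p.41] -/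
theorem piPresentation_hfree :
    ∀ (j : ℕ) (w : 𝒢.graph.Vertex) (z x : D.temperedPi h𝒢), x ∈ (D.piLevelAut h𝒢 hconn j).ker →
      z * x * z⁻¹ ∈ (D.piPresentation h𝒢 T R).H w → x ∈ (D.projAut h𝒢 j).ker := by
  intro j w z x hx hzx
  refine D.ker_piLevelAut_inf_conj_le h𝒢 hconn T R j w z⁻¹ (Subgroup.mem_inf.mpr ⟨hx, ?_⟩)
  -- `x = z⁻¹ (z x z⁻¹) z ∈ z⁻¹ H_w z`
  refine ⟨z * x * z⁻¹, hzx, ?_⟩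
  simp only [MulEquiv.coe_toMonoidHom, MulAut.conj_apply, inv_inv]
  group

/-- **`hfree` for the edge groups**: an element of `ker π_j` conjugate into an edge group `M_e` lies in
`ker ρ_j` (`M_e ≤ H_{ν e}`). [cite: MochizukiSemiAnbd2006, Thm 3.7(iii) p.41] -/
theorem piPresentation_hfreeM :
    ∀ (j : ℕ) (e : 𝒢.graph.Edge) (z x : D.temperedPi h𝒢), x ∈ (D.piLevelAut h𝒢 hconn j).ker →
      z * x * z⁻¹ ∈ (D.piPresentation h𝒢 T R).M e → x ∈ (D.projAut h𝒢 j).ker :=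
  fun j e z x hx hzx => D.piPresentation_hfree h𝒢 hconn T R j (R.ν e) z x hx
    (D.piPresentation_M_le_H h𝒢 T R e hzx)

end GaloisLevelData

end ProfiniteSemiGraph

end Literature.AnabelianGeometry.SemiGraphs
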